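import Summits.AtomisticToContinuum.FouriersLaw.Theorems.BondHeatUncertaintySubdiffusiveBondHeatJunctionRatioBracketCalculus
import Summits.AtomisticToContinuum.FouriersLaw.Theorems.BondHeatUncertaintySubdiffusiveBondHeatJunctionRatioTransferAtoms

/-!
# BondHeatUncertainty › SubdiffusiveBondHeat › JunctionRatio › BracketParity

Helper file for the leaf **[BI] `EscapeGrading.FirstBondBracket`** (route `BondHeatUncertainty`,
residual `BoundedResponse`): the Gibbs piece **(G1a)** of the weak-form skeleton.

The operator identity (C3) of `…JunctionRatioBracketPointwise` reads
`p_j² / T − 1 = A_b Ψ − L (A_b (Lψ) + B_b ψ)` with `ψ = transferTest β N b j`, and the weak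
linearised equation pairs the *source term* `G := A_b (Lψ) + B_b ψ` against the even weight
`p_0² − p_{N-1}²` under the Gibbs density.  This file proves that this pairing — and the pairing of
`G` against ANY momentum-even weight — VANISHES, by momentum-reversal oddness alone:

* §A  coordinate derivatives of even / odd observables under `Θ : (q, p) ↦ (q, −p)`
  (`∂_q` preserves the parity, `∂_p` flips it; unconditional, `partialQ`/`partialP` being
  one-variable `deriv`s);
* §B  the generator (ANY bath temperatures) of an odd observable not depending on the bath momenta
  `p_0, p_{N-1}` is even (the Hamiltonian vector field anti-commutes with `Θ`, the thermostats do
  not see the observable);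
* §C  `A_b` flips and `B_b` preserves the parity; `ψ = transferTest` is odd and, for an interior
  site `j ∉ {0, N-1}`, free of the bath momenta; hence `Lψ` is even and `G` is odd;
* §D  `∫ G · w · e^{-H/T} = 0` for every even weight `w` (tree lemma
  `OddSectorIrreversibility.Corrector.integral_mul_gibbsDensity_eq_zero_of_odd`, no integrability
  needed), the hot / cold cases `(b, j) = (0, 1)`, `(N-1, N-2)` with `w = p_0² − p_{N-1}²`
  (`N ≥ 3`), and the `gibbsMeasure` form.

Integrability of `G · w · e^{-H/T}` (needed where the pairing ENTERS the weak linearised equation)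
is not addressed here; it follows from the tempered-class toolkit once the explicit form of `Lψ` is
paired with it.  Only calculus and the change of variables `p ↦ −p`.
-/

noncomputable section

open MeasureTheory
open Literature.MathematicalPhysics.KineticTheory.HeatConduction

namespace Summit.AtomisticToContinuum.FouriersLaw.Theorems.SubdiffusiveBondHeat.EscapeGrading

variable {N : ℕ}

/-! ## A. Coordinate derivatives of even and odd observables under the momentum flip -/

/-- `−(update (−p) i t) = update p i (−t)`. [bookkeeping] -/
theorem neg_update_neg (p : Fin N → ℝ) (i : Fin N) (t : ℝ) :
    -Function.update (-p) i t = Function.update p i (-t) := by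
  funext j
  by_cases h : j = i
  · subst h; simp
  · simp [Function.update_of_ne h]

/-- `∂_{q_i}` of a momentum-even observable is momentum-even. [calculus] -/
theorem partialQ_flip_of_even {f : PhaseSpace N → ℝ} (hf : ∀ y, f (y.1, -y.2) = f y) (i : Fin N)
    (x : PhaseSpace N) : partialQ i f (x.1, -x.2) = partialQ i f x := by
  unfold partialQ
  dsimp only
  have h : (fun t => f (Function.update x.1 i t, -x.2)) = fun t => f (Function.update x.1 i t, x.2) :=
    funext fun t => hf (Function.update x.1 i t, x.2)
  rw [h]

/-- `∂_{q_i}` of a momentum-odd observable is momentum-odd. [calculus] -/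
theorem partialQ_flip_of_odd {f : PhaseSpace N → ℝ} (hf : ∀ y, f (y.1, -y.2) = -f y) (i : Fin N)
    (x : PhaseSpace N) : partialQ i f (x.1, -x.2) = -partialQ i f x := by
  unfold partialQ
  dsimp only
  have h : (fun t => f (Function.update x.1 i t, -x.2)) = fun t => -f (Function.update x.1 i t, x.2) :=
    funext fun t => hf (Function.update x.1 i t, x.2)
  rw [h, deriv.fun_neg]

/-- `∂_{p_i}` of a momentum-even observable is momentum-odd. [calculus] -/
theorem partialP_flip_of_even {f : PhaseSpace N → ℝ} (hf : ∀ y, f (y.1, -y.2) = f y) (i : Fin N)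
    (x : PhaseSpace N) : partialP i f (x.1, -x.2) = -partialP i f x := by
  unfold partialP
  dsimp only
  have h : (fun t => f (x.1, Function.update (-x.2) i t)) =
      fun t => (fun s => f (x.1, Function.update x.2 i s)) (-t) := by
    funext t
    dsimp only
    rw [← neg_update_neg x.2 i t]
    exact (hf (x.1, Function.update (-x.2) i t)).symm
  rw [h, deriv_comp_neg (fun s => f (x.1, Function.update x.2 i s)) ((-x.2) i)]
  simp

/-- `∂_{p_i}` of a momentum-odd observable is momentum-even. [calculus] -/
theorem partialP_flip_of_odd {f : PhaseSpace N → ℝ} (hf : ∀ y, f (y.1, -y.2) = -f y) (i : Fin N)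
    (x : PhaseSpace N) : partialP i f (x.1, -x.2) = partialP i f x := by
  unfold partialP
  dsimp only
  have h : (fun t => f (x.1, Function.update (-x.2) i t)) =
      fun t => -(fun s => f (x.1, Function.update x.2 i s)) (-t) := by
    funext t
    dsimp only
    rw [← neg_update_neg x.2 i t]
    have hy := hf (x.1, Function.update (-x.2) i t)
    dsimp only at hy
    rw [hy, neg_neg]
  rw [h, deriv.fun_neg, deriv_comp_neg (fun s => f (x.1, Function.update x.2 i s)) ((-x.2) i)]
  simp

/-! ## B. The generator of an odd, bath-free observable is even -/

/-- If `f` is odd under `(q,p) ↦ (q,−p)` and does not depend on the bath momenta (`∂_{p_b} f = 0`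
for `b ∈ {0, N−1}`), then `L_{T_L,T_R} f` is even, for ANY bath temperatures: the Hamiltonian
vector field anti-commutes with the flip and the thermostat terms vanish identically. [calculus] -/
theorem generator_flip_of_odd (P : OscillatorChain) (T_L T_R : ℝ) {f : PhaseSpace N → ℝ}
    (hf : ∀ y, f (y.1, -y.2) = -f y)
    (hb : ∀ b : Fin N, (b.val = 0 ∨ b.val = N - 1) → partialP b f = 0) (x : PhaseSpace N) :
    P.generator N T_L T_R f (x.1, -x.2) = P.generator N T_L T_R f x := by
  have hPf : ∀ b : Fin N, (b.val = 0 ∨ b.val = N - 1) → ∀ y, partialP b f y = 0 := fun b hb' y => by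
    rw [hb b hb']; rfl
  have hPPf : ∀ b : Fin N, (b.val = 0 ∨ b.val = N - 1) → ∀ y, partialP b (partialP b f) y = 0 := by
    intro b hb' y
    rw [hb b hb']
    unfold partialP
    simp
  have hH : ∀ i, partialQ i (P.hamiltonian N) (x.1, -x.2) = partialQ i (P.hamiltonian N) x := fun i => by
    rw [P.partialQ_hamiltonian_eq, P.partialQ_hamiltonian_eq]
  unfold OscillatorChain.generator
  congr 1
  · refine Finset.sum_congr rfl fun i _ => ?_
    rw [partialQ_flip_of_odd hf, partialP_flip_of_odd hf, hH]
    simp only [Pi.neg_apply]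
    ring
  · congr 1
    refine Finset.sum_congr rfl fun i _ => ?_
    congr 1
    · split_ifs with h0
      · rw [hPf i (Or.inl h0), hPf i (Or.inl h0), hPPf i (Or.inl h0), hPPf i (Or.inl h0)]
        simp
      · rfl
    · split_ifs with h1
      · rw [hPf i (Or.inr h1), hPf i (Or.inr h1), hPPf i (Or.inr h1), hPPf i (Or.inr h1)]
        simp
      · rfl

/-! ## C. Parity of `A_b`, `B_b`, `ψ`, `Lψ` and of the source term `G` -/

/-- `A_b = p_b/T − ∂_{p_b}` FLIPS the momentum parity: `A_b` of an even observable is odd. [calculus] -/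
theorem adjointP_flip_of_even (T : ℝ) (b : Fin N) {φ : PhaseSpace N → ℝ}
    (hφ : ∀ y, φ (y.1, -y.2) = φ y) (x : PhaseSpace N) :
    adjointP T b φ (x.1, -x.2) = -adjointP T b φ x := by
  unfold adjointP
  rw [partialP_flip_of_even hφ, hφ]
  simp only [Pi.neg_apply]
  ring

/-- `B_b = (∂_{q_b}H)/T − ∂_{q_b}` PRESERVES the momentum parity: `B_b` of an odd observable is
odd. [calculus] -/
theorem adjointQ_flip_of_odd (P : OscillatorChain) (T : ℝ) (b : Fin N) {φ : PhaseSpace N → ℝ}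
    (hφ : ∀ y, φ (y.1, -y.2) = -φ y) (x : PhaseSpace N) :
    adjointQ P T b φ (x.1, -x.2) = -adjointQ P T b φ x := by
  unfold adjointQ
  rw [partialQ_flip_of_odd hφ, hφ, P.partialQ_hamiltonian_eq, P.partialQ_hamiltonian_eq]
  ring

/-- `ψ = transferTest β N i j = p_j / V″(q_j − q_i)` is momentum-odd. [calculus] -/
theorem transferTest_flip (β : ℝ) (i j : Fin N) (x : PhaseSpace N) :
    transferTest β N i j (x.1, -x.2) = -transferTest β N i j x := by
  unfold transferTest
  simp only [Pi.neg_apply]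
  ring

/-- `ψ_{ij}` does not depend on `p_l` for `l ≠ j`. [calculus] -/
theorem partialP_transferTest_eq_zero (β : ℝ) {i j l : Fin N} (hl : l ≠ j) :
    partialP l (transferTest β N i j) = 0 := by
  rw [partialP_transferTest_fun]
  funext x
  simp [Ne.symm hl]

/-- **`Lψ` is even** for an interior transferred site `j ∉ {0, N−1}` (any bath temperatures).
[calculus] -/
theorem generator_transferTest_flip (P : OscillatorChain) (T_L T_R β : ℝ) {i j : Fin N}
    (hj0 : j.val ≠ 0) (hj1 : j.val ≠ N - 1) (x : PhaseSpace N) :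
    P.generator N T_L T_R (transferTest β N i j) (x.1, -x.2) =
      P.generator N T_L T_R (transferTest β N i j) x :=
  generator_flip_of_odd P T_L T_R (transferTest_flip β i j)
    (fun b hb => partialP_transferTest_eq_zero β (by rintro rfl; omega)) x

/-- **The source term `G = A_b (Lψ) + B_b ψ` is momentum-odd** (`j ∉ {0, N−1}`; any bath
temperatures in `L`, any `T` in the adjoints). [calculus] -/
theorem transferSource_flip (P : OscillatorChain) (T_L T_R T β : ℝ) (b : Fin N) {i j : Fin N}
    (hj0 : j.val ≠ 0) (hj1 : j.val ≠ N - 1) (x : PhaseSpace N) :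
    adjointP T b (P.generator N T_L T_R (transferTest β N i j)) (x.1, -x.2)
        + adjointQ P T b (transferTest β N i j) (x.1, -x.2) =
      -(adjointP T b (P.generator N T_L T_R (transferTest β N i j)) x
        + adjointQ P T b (transferTest β N i j) x) := by
  rw [adjointP_flip_of_even T b (generator_transferTest_flip P T_L T_R β hj0 hj1),
    adjointQ_flip_of_odd P T b (transferTest_flip β i j)]
  ring

/-! ## D. (G1a): the source term has zero Gibbs weight against every even weight -/

/-- **(G1a), general form.** `∫ (A_b (Lψ) + B_b ψ) · w · e^{-H/T} dq dp = 0` for every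
momentum-even weight `w` and every interior transferred site `j ∉ {0, N−1}` — the integrand is
momentum-odd (no integrability needed: both sides are the same Bochner integral). [statics] -/
theorem integral_transferSource_mul_gibbsDensity_eq_zero (P : OscillatorChain) (T_L T_R T β : ℝ)
    (b : Fin N) {i j : Fin N} (hj0 : j.val ≠ 0) (hj1 : j.val ≠ N - 1) {w : PhaseSpace N → ℝ}
    (hw : ∀ y, w (y.1, -y.2) = w y) :
    ∫ x, (adjointP T b (P.generator N T_L T_R (transferTest β N i j)) x
        + adjointQ P T b (transferTest β N i j) x) * w x * P.gibbsDensity N T x = 0 :=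
  OddSectorIrreversibility.Corrector.integral_mul_gibbsDensity_eq_zero_of_odd P N T fun x => by
    rw [transferSource_flip P T_L T_R T β b hj0 hj1, hw]
    ring

/-- The weight `p_a² − p_c²` is momentum-even. [bookkeeping] -/
theorem sq_sub_sq_flip (a c : Fin N) (y : PhaseSpace N) :
    (fun x : PhaseSpace N => x.2 a ^ 2 - x.2 c ^ 2) (y.1, -y.2) = y.2 a ^ 2 - y.2 c ^ 2 := by
  simp only [Pi.neg_apply]
  ring

/-- **(G1a), hot clause** (`N ≥ 3`, `(b, j) = (0, 1)`, weight `p_0² − p_{N−1}²`, `L = L_{T,T}`):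
`c(G) = ∫ (A_0 (Lψ_{01}) + B_0 ψ_{01}) (p_0² − p_{N−1}²) e^{-H/T} = 0`. [statics] -/
theorem integral_transferSource_mul_gibbsDensity_eq_zero_hot (P : OscillatorChain) (T β : ℝ)
    (hN : 3 ≤ N) :
    ∫ x, (adjointP T ⟨0, by omega⟩
            (P.generator N T T (transferTest β N ⟨0, by omega⟩ ⟨1, by omega⟩)) x
          + adjointQ P T ⟨0, by omega⟩ (transferTest β N ⟨0, by omega⟩ ⟨1, by omega⟩) x)
        * (x.2 ⟨0, by omega⟩ ^ 2 - x.2 ⟨N - 1, by omega⟩ ^ 2) * P.gibbsDensity N T x = 0 :=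
  integral_transferSource_mul_gibbsDensity_eq_zero P T T T β _ (by simp) (by simp; omega)
    (sq_sub_sq_flip _ _)

/-- **(G1a), cold clause** (`N ≥ 3`, `(b, j) = (N−1, N−2)`, weight `p_0² − p_{N−1}²`):
`∫ (A_{N−1} (Lψ') + B_{N−1} ψ') (p_0² − p_{N−1}²) e^{-H/T} = 0`. [statics] -/
theorem integral_transferSource_mul_gibbsDensity_eq_zero_cold (P : OscillatorChain) (T β : ℝ)
    (hN : 3 ≤ N) :
    ∫ x, (adjointP T ⟨N - 1, by omega⟩
            (P.generator N T T (transferTest β N ⟨N - 1, by omega⟩ ⟨N - 1 - 1, by omega⟩)) x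
          + adjointQ P T ⟨N - 1, by omega⟩
            (transferTest β N ⟨N - 1, by omega⟩ ⟨N - 1 - 1, by omega⟩) x)
        * (x.2 ⟨0, by omega⟩ ^ 2 - x.2 ⟨N - 1, by omega⟩ ^ 2) * P.gibbsDensity N T x = 0 :=
  integral_transferSource_mul_gibbsDensity_eq_zero P T T T β _ (by simp; omega) (by simp; omega)
    (sq_sub_sq_flip _ _)

/-- **(G1a), `gibbsMeasure` form.** `∫ (A_b (Lψ) + B_b ψ) · w dμ_T = 0` for every even weight `w`
(`j ∉ {0, N−1}`). [statics] -/
theorem integral_transferSource_mul_gibbsMeasure_eq_zero (P : OscillatorChain) (T_L T_R T β : ℝ)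
    (b : Fin N) {i j : Fin N} (hj0 : j.val ≠ 0) (hj1 : j.val ≠ N - 1) {w : PhaseSpace N → ℝ}
    (hw : ∀ y, w (y.1, -y.2) = w y) :
    ∫ x, (adjointP T b (P.generator N T_L T_R (transferTest β N i j)) x
        + adjointQ P T b (transferTest β N i j) x) * w x ∂(P.gibbsMeasure N T) = 0 := by
  rw [OscillatorChain.integral_gibbsMeasure,
    integral_transferSource_mul_gibbsDensity_eq_zero P T_L T_R T β b hj0 hj1 hw, mul_zero]

end Summit.AtomisticToContinuum.FouriersLaw.Theorems.SubdiffusiveBondHeat.EscapeGrading
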